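import Summits.BirchSwinnertonDyer.BirchSwinnertonDyer.Theorems.Rank1ResidualX9Defs
import Summits.BirchSwinnertonDyer.Rank1Residual.GaloisImage.IsogenySurjTransport
import Summits.BirchSwinnertonDyer.Rank1Residual.X12.CMIsogenyInvariance
import Literature.NumberTheory.EllipticCurves.IsogenyFrobeniusTraceProofs
import Literature.NumberTheory.EllipticCurves.BSDSelmerCMPConverseMaximalOrderProofs
import Literature.NumberTheory.EllipticCurves.IsogenyDualProofs
import HarnessLib

/-!
# Class X9 is a `ℚ`-isogeny invariant
# (cell `b2b-bsdres`, X9 prover, unit `b2b-bsdres-x9` gen 46; CLASS-CLOSURE E3 "transport" for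
# §a.2 X9 — the isogeny relation, companion of `X9/TwistStability.lean`)

HONEST FRAMING (run/shared/lean/b2b/bsd-rank1-residual/, verbatim in every file): the goal of the
cell is to DELETE the COMBINATION-SHAPED residual classes of the Birch–Swinnerton-Dyer formula for
ALL analytic-rank `≤ 1` elliptic curves over `ℚ` — "full BSD formula for every rank `≤ 1` curve in
class `C`" assembled STRICTLY from published theorems — so that the rank-`≤ 1` remainder becomes
exactly the CONSTRUCTION-SHAPED classes, which are TYPED (missing-input `Prop`s), NOT attempted.
This is not "finishing BSD". Class X9 (`p ≥ 5` good ordinary, `E[p]` irreducible, `ρ̄_{E,p}` NOT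
surjective, `E` without CM) is and stays TYPED at class level (residue
`IntegralMainConjectureOnClassX9` / `BSDpOnClassX9` of `Theorems/Rank1ResidualX9Defs.lean`).
THEOREMS ONLY (no definition, no named fact, nothing about any particular curve asserted); no
label of the cell moves; nothing is booked.

## What this file proves, and why

For globally minimal `W, W'` over `ℚ` with `E = W` and `E' = W'` `ℚ`-isogenous
(`WeierstrassCurve.IsIsogenous W W'`) and the K6 class predicate
`Summit.BirchSwinnertonDyer.BirchSwinnertonDyer.Rank1Residual.ClassX9`
(`¬ CM ∧ 5 ≤ p ∧ good(p) ∧ p ∤ a_p ∧ irr(p) ∧ ¬ surj(p)`):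

* `classX9_of_isIsogenous`, **`IsIsogenous.classX9_iff`** — `W ∈ X9 ↔ W' ∈ X9` at `p`. Every
  clause is a `ℚ`-isogeny invariant, and each transport is ALREADY a tree theorem; this file only
  assembles them for the class: CM (*AEC* III.6, the cell's `X12.hasCM_of_isIsogenous`), good
  reduction at `p` (*AEC* VII.7.2, `IsIsogenous.hasGoodReductionAtPrime_iff`), `a_p` (Faltings,
  `frobeniusTrace_eq_of_isIsogenous`), reducibility of `E[p]` (`X2.red_iff_of_isIsogenous`), and —
  on an irreducible isogeny class, which is connected by isogenies of degree prime to `p`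
  identifying `E[p] ≅ E'[p]` `Γ_ℚ`-equivariantly — surjectivity of `ρ̄`
  (`GaloisImage.surj_iff_of_isIsogenous_of_irr`, *AEC* III.4.11).

READING (E3 for X9): an X9 pair has no isogenous partner outside X9 (so the per-pair census may be
read per isogeny class); together with `X9/TwistStability.lean` (closure under the twists
unramified at `p`, exit to X4 by the ramified ones) this is the class's full "open pair ↔ partner"
structure under the census's two relations.

References: [SilvermanAEC2009] III.4 Cor. 4.11, III.6 Thm. 6.1, VII.7 Cor. 7.2;
[Faltings1983Endlichkeit] §5 Kor. 2. Design: theorems only; default heartbeats; axioms standard.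
-/

set_option autoImplicit false

noncomputable section

open scoped Classical

open WeierstrassCurve Literature.NumberTheory.EllipticCurves

open Literature.NumberTheory.EllipticCurves.Rank1Residual hiding ClassX9
open Summit.BirchSwinnertonDyer.BirchSwinnertonDyer.Rank1Residual (ClassX9)

namespace Summit.BirchSwinnertonDyer.Rank1Residual.X9

variable {W W' : WeierstrassCurve ℚ} [W.IsElliptic] [W'.IsElliptic] [W.IsGloballyMinimal]
  [W'.IsGloballyMinimal] (p : ℕ) [hp : Fact p.Prime]

/-- **Class X9 passes along a `ℚ`-isogeny**: `W ∈ X9` at `p` and `E ∼_ℚ E'` ⟹ `W' ∈ X9` at `p`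
(CM, good reduction, `a_p`, irreducibility of `E[p]` and — given irreducibility — surjectivity of
`ρ̄` are `ℚ`-isogeny invariants). [cite: SilvermanAEC2009, Cor. III.4.11, Thm. III.6.1 and Cor. VII.7.2]
[cite: Faltings1983Endlichkeit, §5 Korollar 2, (i) ⇒ (iv)] -/
theorem classX9_of_isIsogenous (h : IsIsogenous W W') (hX : ClassX9 W p) : ClassX9 W' p := by
  obtain ⟨hcm, h5, hgood, hord, hirr, hns⟩ := hX
  have hgood' : W'.HasGoodReductionAtPrime p := (h.hasGoodReductionAtPrime_iff p).mp hgood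
  have hirr' : Irr W' p := by
    by_contra hred'
    exact (X2.red_iff_of_isIsogenous (p := p) h).mpr hred' hirr
  refine ⟨fun hcm' ↦ hcm (X12.hasCM_of_isIsogenous h.symm_of_charZero hcm'), h5, hgood', ?_,
    hirr', fun hs ↦ hns ((GaloisImage.surj_iff_of_isIsogenous_of_irr h hirr).mpr hs)⟩
  rwa [← frobeniusTrace_eq_of_isIsogenous h p hgood hgood']

/-- **`W ∈ X9 ↔ W' ∈ X9` for `ℚ`-isogenous globally minimal `W, W'`**: class X9 is a
`ℚ`-isogeny invariant (E3 reading: an X9 pair has no isogenous partner outside X9).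
[cite: SilvermanAEC2009, Cor. III.4.11, Thm. III.6.1 and Cor. VII.7.2]
[cite: Faltings1983Endlichkeit, §5 Korollar 2, (i) ⇒ (iv)] -/
theorem IsIsogenous.classX9_iff (h : IsIsogenous W W') : ClassX9 W p ↔ ClassX9 W' p :=
  ⟨classX9_of_isIsogenous p h, classX9_of_isIsogenous p h.symm_of_charZero⟩

end Summit.BirchSwinnertonDyer.Rank1Residual.X9

end
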